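import Summits.QuantumFields.BalabanUV.T4Continuum.Support.RegionElectricCornerNorm
import Summits.QuantumFields.BalabanUV.T4Continuum.Support.RegionGaugeResolventSplit

/-!
# T⁴ programme, spine node NE2 (U1a), sub-row Δ1 «NE2⁰-Dirichlet» — PRINT's TWO-ZONE LOCAL OPERATOR
# `localTZ(Ω₀ ⊃ Ω₁) = ∂*∂ + ∂_{Ω₀}∂_{Ω₀}* + a n^d QᴴQ + a n²·1_{Λ₀}` ON THE STAR BONDS OF THE OUTER REGION, with (3.16)'s `j = 0` COLLAR MASS:
# the FULL gradient energy of the zero-extension is `≤ (1 + 4d/a)·⟨A, localTZ A⟩` and `localTZ ≥ γ_D·a/(a+4d)` — ONE constant for EVERY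
# geometry of the inner region `Ω₁` (re-entrant corners, diagonal contacts, anything), because `∂Ω₁` is INTERIOR to the outer region

NE2 formalisation swarm `b2b-balaban-t4-ne2-formalise-*`, LEAF PROVER 05 (gen 10), own-initiative supplier brick «Δ1-COLLAR-LOCAL» for gen 16's
ITEM 1 = the dictionary fork G-ne2p1-g15-6 (owner rulings R44 (c) / R45 (d), QUESTION OF RECORD «which compression is [B9] (3.27) for bond
fields?», T4-DAG writer's ANSWER Q51 «type the collar»; journal 2026-08-21 l.24079 / l.24218 / l.24241 / l.24324; INTENT l.24547).

WHAT IS PRINTED (OCR texts `paper:balaban1985-cmp99-background-propagators` pp.393–395, `paper:balaban1984-cmp96-propagators-rt-ii` pp.224–226,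
read by this seat).  [Balaban1984PropagatorsII] p.224: «If Ω ⊂ T_η, then we denote by Ω also the set of bonds ∪_{x∈Ω} st(x) = {bonds b ⊂ T_η:
at least one end-point of b belongs to Ω}. Let us define Λ_j = Ω_j ∖ Ω_{j+1} (2.3) for the sets of sites and the sets of bonds»; (2.7) «λ = 0 on
Λ₀, Q′_jλ = 0 on Λ_j»; p.225 (2.10) «R … an orthogonal projection in the space L²(T_η) onto the subspace ΔN(Q′)»; p.226 (2.20) «for b ∈ Λ₀,
(Q₀A)(b) = A(b)».  [Balaban1985BackgroundPropagators] p.393 (3.16) «⟨A, Q*aQ A⟩ = Σ_{j=0}^{k} a Σ_{b∈Λ_j} (L^jη)^{d−2} |(Q_j(U)A)(b)|²»; p.394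
(3.20)–(3.21) «R = R(U) is an orthogonal projection in the Hilbert space L²(Ω₀, g) onto the subspace R = Δ^η_U N(Q′)»; p.394 l.24–27 «a domain
Ω₀ such that Ω₁ ⊂ Ω₀ and Ω₀ is a union of big blocks …, e.g. Ω₀ = {a union of big blocks with distances to Ω₁ ≤ RM}»; p.395 (3.26)–(3.27)
«Δ_a = Δ + DRD* + Q*aQ … Δ_a↾Ω₀ = Ω₀Δ_aΩ₀ … G(U) = G = (Δ_a↾Ω₀)⁻¹».

TWO LOCATED READINGS (this seat; recorded for the c5/B0 dictionary owners, no ruling implied).  (R1) By (2.3) read on BOND sets, the `j = 0`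
layer of (3.16) is `Λ₀ = st(Ω₀) ∖ st(Ω₁)` — the bonds of `Ω₀` NOT touching `Ω₁` — EXACTLY leaf-07-g6's `RegionGaugeTwoZone.collar S₀ S₁`
(p226989); the normal interface bonds (one end in `Ω₁`, one in `Λ₀`) belong to `st(Ω₁)` and carry the `j = 1` block averaging, no η-scale mass.
(R2) By (3.20)–(3.21) / (2.10) print's `R` acts on `L²(Ω₀)` (ALL sites of the outer region): the gauge block `D R D*` of (3.26)↾Ω₀ consumes the
divergence at EVERY `Ω₀`-site, collar sites included — `Dg = gradR n M S₀` in the tree's vocabulary; the two-zone file's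
`gradR₂ = GradOp.toBlock (starReg S₀) (blockReg S₁)` with `R(Ω₁)` is a DIFFERENT operator (its `SliceCoercive₂ ⟺ SliceCoercive(S₁)`, p227556, is
about that operator).  With (R2) the owner's generic split `gaugeFixed = localFixed − sandwich` (`RegionGaugeResolventSplit`) shows that the
LOCAL part of print's collared operator — whatever the collared scalar data `G′(Ω₀)`, `Q′` of (3.24)–(3.25) are — is
**`localTZ S₀ S₁ := localFixed (curlR S₀) (gradR S₀) (Qv₂ S₀ S₁) a = regionDeltaLoc n M a S₀ + a n²·selCᴴselC`** (`localTZ_eq`): THE SINGLE-ZONE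
LOCAL OPERATOR OF THE OUTER REGION plus the collar mass.  The inner region's boundary is INTERIOR to it.

WHAT THIS FILE PROVES ([folklore] lattice bookkeeping over landed modules BY NAME; 0 sorry).  §1 `Collared S₀ S₁` (parametric shape on data:
every face-neighbour of an `Ω₁`-site lies in `Ω₀`), `collared_of_blocks` (print's «Ω₀ ⊇ Ω₁ + a layer of big blocks» implies it), and
`collar_of_exterior` (then every star bond of `Ω₀` touching `Ω₀ᶜ` is a collar bond).  §2 `localTZ`, `localTZ_eq`, `form_localTZ`
(`= ‖curl A‖² + ‖∂_{Ω₀}ᴴA‖² + a n^d‖QA‖² + a n²‖A_{Λ₀}‖²`), `form_gaugeFixed_le_form_localTZ` (for ANY Hermitian `G` on `L²(Ω₀)` and ANY `Qs`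
with `Qs G² Qsᴴ` invertible the faithful operator `gaugeFixed (curlR S₀) (gradR S₀) G Qs (Qv₂ S₀ S₁) a` is dominated by `localTZ`).
§3 **`extFlux_le_collar`**: the outer wall's electric flux is carried by collar bonds, `extFlux n M S₀ A ≤ 4d·n²·nsq (selC A)`.
§4 **`gradEnergy_le_form_localTZ (hsub) (hcol : Collared) (ha : 0 < a)`**: `Σ_ν nsq (fdiff ν (ext A)) ≤ (1 + 4d/a)·re⟨A, localTZ A⟩` for EVERY
star field of `Ω₀` — the FULL componentwise gradient energy of the zero-extension (hence `interiorW2_localTZ`) with ONE level-uniform constant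
and NO hypothesis on the geometry of `Ω₁`.  Contrast (numerics of record, leaf-07-g10 memo `t4/T4-EST-NE2-D1-REENTRANT.md`, owner EST §G15.0 (E)):
for the SINGLE-zone `regionDeltaLoc S` the form-domain W2 constant grows like `n^{2/3}` at re-entrant corners of `S` — the electric corner mode
sits at `∂Ω(S)`, which in print's geometry is the far wall `∂Ω₀` inside the massive collar, where §3 pays for it.
§5 **`coercive_localTZ (hsub) (hcol) (hn : 1 ≤ n) (ha : 0 < a) : Coercive (localTZ …) (gamTZ d a)`**, `gamTZ = γ_D·a/(a + 4d)` with B5's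
`γ_D = gamD d a` (`coercive_calDa` on the zero-extension + the Gaffney identity of `Ω₀` + §3); hence `isUnit_det_localTZ`,
`opNorm_inv_localTZ_le` — «the local collared propagator exists with ‖·‖ ≤ gamTZ⁻¹», every pair `S₁ ≤ S₀`, every `n`, `M`.

WHAT IS NOT CLAIMED.  No two-level law / rate; no W1 (`SliceCoercive`) for the FAITHFUL collared operator `localTZ − sandwich` (its
`R(Ω₀)`-slice differs from both typed slices; the collared scalar data `Q′ = [block means on Ω₁-blocks; identity on Λ₀-sites]`,
`Δ′ = −Δ_D(Ω₀) + a′(n^d Q₁′ᴴQ₁′ + n²·1_{Λ₀})` of (3.24) are NOT typed here); no Hessian / (R-loc) budget (the collar indicator is sharp);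
[B9]'s graded layers `Λ₁, …, Λ_{k−1}` and the background are not modelled; the averaging rows of `avgR S₀` on collar blocks are a modelling
surplus over print's `j = 1` rows (at most the collar mass once more).  The c5/B0 dictionary ruling stays with its owners.

HONEST FRAMING (T4-DAG p. 1).  Model level (`U = 1`, two zones, ONE averaging scale, finite torus, operator norm); constants OURS; nothing
printed is a hypothesis or a conclusion; NE2 (U1a) NOT proved; spine PROVED 0/9 unchanged; NOT [B9] (3.16)/(3.23)–(3.27) as printed; NOT
infinite volume / mass gap / Clay.  HONEST DEPENDENCY: continuum YM on T⁴ ⇐ BetaPertH ∧ nine spine estimates (0/9 proved); BetaPertH ⇐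
(D1) ∧ (D4) ∧ CAP+tail; G-an2-4 gates asym, D1 and NE2/3/4.  No `sorry`.
-/

noncomputable section

open scoped BigOperators ComplexConjugate Matrix Matrix.Norms.L2Operator
open Finset

namespace Summit.QuantumFields.BalabanUV.T4Continuum.RegionTwoZoneLocal

open Literature.MathematicalPhysics.QuantumFieldTheory.Balaban1983to89.B5Prop11Plancherel (Tor fine fdiff unitVec)
open Literature.MathematicalPhysics.QuantumFieldTheory.Balaban1983to89.B5Prop11Lower (nsq nsq_nonneg star_dotProduct_self)
open Literature.MathematicalPhysics.QuantumFieldTheory.Balaban1983to89.B5Action121 (GradOp CurlOp form_gram_rect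
  dotProduct_mulVec_eq_star_conjTranspose_mulVec)
open Literature.MathematicalPhysics.QuantumFieldTheory.Balaban1983to89.B5Block118 (QvOp)
open Literature.MathematicalPhysics.QuantumFieldTheory.Balaban1983to89.B5Blocks16 (blockOf)
open Literature.MathematicalPhysics.QuantumFieldTheory.Balaban1983to89.B5Value126 (PcT PcT_mul_PcT PcT_conjTranspose one_sub_PcT_proj)
open Literature.MathematicalPhysics.QuantumFieldTheory.Balaban1983to89.B5DeltaA169 (DeltaA QvAdj calDa_eq_DeltaA DeltaA_eq_curl)
open Summit.QuantumFields.BalabanUV.T4Continuum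
open Summit.QuantumFields.BalabanUV.T4Continuum.SubtypeCompression (Coercive ext ext_apply_of ext_apply_of_not nsq_ext
  isUnit_det_of_coercive opNorm_inv_le_of_coercive)
open Summit.QuantumFields.BalabanUV.T4Continuum.ScalarBlockPoincare (nsq_smul)
open Summit.QuantumFields.BalabanUV.T4Continuum.RegionGaugeProjection (gramK)
open Summit.QuantumFields.BalabanUV.T4Continuum.RegionGaugeSlice (gaugeFixed form_gram form_proj)
open Summit.QuantumFields.BalabanUV.T4Continuum.RegionGaugeFixedVector (starReg curlR gradR avgR GradOp_apply)
open Summit.QuantumFields.BalabanUV.T4Continuum.RegionGaugeFixedVectorFlat (avgR_mulVec blockOf_add_unitVec)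
open Summit.QuantumFields.BalabanUV.T4Continuum.RegionGaugeSliceTorus (nsq_curlR_mulVec)
open Summit.QuantumFields.BalabanUV.T4Continuum.RegionGaugeTwoZone (collar selC selC_mulVec Qv₂ nsq_Qv₂_mulVec)
open Summit.QuantumFields.BalabanUV.T4Continuum.RegionGaugeResolventSplit (localFixed form_localFixed localFixed_isHermitian
  form_gaugeFixed_le_form_localFixed regionDeltaLoc regionDeltaLoc_eq sqrt_mul_sqrt_pow)
open Summit.QuantumFields.BalabanUV.T4Continuum.RegionGaffneyIdentity (extFlux extFlux_nonneg nsq_div_ext_eq gaffney_region)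
open Summit.QuantumFields.BalabanUV.T4Continuum.RegionStarBoundaryCharges (cntR cntR_nonneg sum_nsq_fdiff_ext_eq)
open Summit.QuantumFields.BalabanUV.T4Continuum.RegionElectricCornerNorm (nsq_GradOp_conjTranspose_mulVec_le)
open Summit.QuantumFields.BalabanUV.T4Continuum.DirichletStarRenormTower (igrad)
open Summit.QuantumFields.BalabanUV.T4Continuum.DirichletRegionTower (gamD gamD_pos coercive_calDa)
open Summit.QuantumFields.BalabanUV.Beta.GAN24.DirichletBoxTrace (blockReg)

variable {d : ℕ} (n : ℕ) [NeZero n] (M : Fin d → ℕ) [hM : ∀ μ, NeZero (M μ)] (a : ℝ) (S₀ S₁ : Tor M → Prop)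
  [DecidablePred S₀] [DecidablePred S₁]

/-! ## §1 The collar condition -/

omit [DecidablePred S₀] [DecidablePred S₁] in
/-- **THE COLLAR CONDITION** (parametric shape on data): every face-neighbour of a site of the inner region `Ω₁ = blockReg S₁` lies in the
outer region `Ω₀ = blockReg S₀` — print's «Ω₀ ⊇ Ω₁ + a layer of big blocks» read at the level of sites.
[cite: Balaban1985BackgroundPropagators, p.394 (shape: Ω₀ ⊇ Ω₁)] [folklore] -/
def Collared : Prop :=
  ∀ x : Tor (fine n M), blockReg n M S₁ x → ∀ ν : Fin d,
    blockReg n M S₀ (x + unitVec (fine n M) ν) ∧ blockReg n M S₀ (x - unitVec (fine n M) ν)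

omit [DecidablePred S₀] [DecidablePred S₁] in
/-- **UNDER THE COLLAR CONDITION A STAR BOND OF `Ω₀` TOUCHING `Ω₀ᶜ` IS A COLLAR BOND** (it cannot touch `Ω₁`). [folklore] -/
theorem collar_of_exterior (hsub : ∀ y, S₁ y → S₀ y) (hcol : Collared n M S₀ S₁) {b : Tor (fine n M) × Fin d}
    (hb : starReg n M S₀ b) (hx : ¬ blockReg n M S₀ b.1 ∨ ¬ blockReg n M S₀ (b.1 + unitVec (fine n M) b.2)) :
    collar n M S₀ S₁ b := by
  refine ⟨hb, ?_⟩
  rintro (h1 | h2)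
  · -- `b.1 ∈ Ω₁`
    have h1' : blockReg n M S₀ b.1 := hsub _ h1
    rcases hx with hx | hx
    · exact hx h1'
    · exact hx (hcol _ h1 b.2).1
  · -- `b.1 + e ∈ Ω₁`
    have h2' : blockReg n M S₀ (b.1 + unitVec (fine n M) b.2) := hsub _ h2
    rcases hx with hx | hx
    · have h := (hcol _ h2 b.2).2
      rw [add_sub_cancel_right] at h
      exact hx h
    · exact hx h2'

omit [DecidablePred S₀] [DecidablePred S₁] in
/-- **PRINT's COLLAR AT THE LEVEL OF BLOCKS IMPLIES THE COLLAR CONDITION**: if every block of `S₁` and each of its `2d` face-neighbours lies in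
`S₀` («Ω₀ = Ω₁ + a layer of big blocks»), then `Collared n M S₀ S₁` (a fine site's face-neighbour lies in the same block or in the
face-adjacent one, `blockOf_add_unitVec`). [cite: Balaban1985BackgroundPropagators, p.394 (shape: Ω₀ ⊇ Ω₁ + a layer)] [folklore] -/
theorem collared_of_blocks (h : ∀ y, S₁ y → S₀ y ∧ ∀ ν, S₀ (y + unitVec M ν) ∧ S₀ (y - unitVec M ν)) : Collared n M S₀ S₁ := by
  intro x hx ν
  have hx' : S₁ (blockOf n M x) := hx
  obtain ⟨h0, h1⟩ := h _ hx'
  refine ⟨?_, ?_⟩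
  · show S₀ (blockOf n M (x + unitVec (fine n M) ν))
    rcases blockOf_add_unitVec n M x ν with e | e
    · rw [e]; exact h0
    · rw [e]; exact (h1 ν).1
  · show S₀ (blockOf n M (x - unitVec (fine n M) ν))
    rcases blockOf_add_unitVec n M (x - unitVec (fine n M) ν) ν with e | e
    · rw [sub_add_cancel] at e
      rw [← e]; exact h0
    · rw [sub_add_cancel] at e
      have e' : blockOf n M (x - unitVec (fine n M) ν) = blockOf n M x - unitVec M ν := eq_sub_of_add_eq e.symm
      rw [e']; exact (h1 ν).2

/-! ## §2 The two-zone local operator -/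

/-- **PRINT's TWO-ZONE LOCAL OPERATOR** `localTZ = ∂*∂ + ∂_{Ω₀}∂_{Ω₀}ᴴ + a n^d·QᴴQ + a n²·1_{Λ₀}` on the star bonds of `Ω₀` — the owner's
generic `localFixed` with the outer region's curl and Ω₀-ranged gradient (reading (R2)) and leaf-07-g6's two-zone mass map `Qv₂`
((3.16), `j = 1` rows + `j = 0` collar rows, reading (R1)).
[cite: Balaban1985BackgroundPropagators, (3.16)/(3.26) pp.393–395 (shape)] [folklore] -/
def localTZ : Matrix {b // starReg n M S₀ b} {b // starReg n M S₀ b} ℂ :=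
  localFixed (curlR n M S₀) (gradR n M S₀) (Qv₂ n M S₀ S₁) a

/-- `Qv₂ᴴQv₂ = n^d·QᴴQ + n²·selCᴴselC`. [folklore] -/
theorem Qv₂_conjTranspose_mul_Qv₂ :
    (Qv₂ n M S₀ S₁)ᴴ * Qv₂ n M S₀ S₁
      = ((n : ℂ) ^ d) • ((avgR n M S₀)ᴴ * avgR n M S₀) + ((n : ℂ) ^ 2) • ((selC n M S₀ S₁)ᴴ * selC n M S₀ S₁) := by
  rw [Qv₂, Matrix.conjTranspose_fromRows_eq_fromCols_conjTranspose, Matrix.fromCols_mul_fromRows,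
    Matrix.conjTranspose_smul, Matrix.conjTranspose_smul, Matrix.smul_mul, Matrix.mul_smul, smul_smul,
    Matrix.smul_mul, Matrix.mul_smul, smul_smul]
  congr 2
  · rw [Complex.star_def, Complex.conj_ofReal, sqrt_mul_sqrt_pow]
  · rw [Complex.star_def, map_natCast, sq]

/-- **`localTZ = regionDeltaLoc(S₀) + a n²·selCᴴselC`**: the single-zone local operator OF THE OUTER REGION plus the collar mass.
[cite: Balaban1985BackgroundPropagators, (3.16) p.393 (shape: the j = 0 term)] [folklore] -/
theorem localTZ_eq :
    localTZ n M a S₀ S₁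
      = regionDeltaLoc n M a S₀ + ((a * (n : ℝ) ^ 2 : ℝ) : ℂ) • ((selC n M S₀ S₁)ᴴ * selC n M S₀ S₁) := by
  have hc : ((a * (n : ℝ) ^ d : ℝ) : ℂ) = (a : ℂ) * (n : ℂ) ^ d := by push_cast; ring
  have he : ((a * (n : ℝ) ^ 2 : ℝ) : ℂ) = (a : ℂ) * (n : ℂ) ^ 2 := by push_cast; ring
  rw [localTZ, localFixed, regionDeltaLoc_eq, Qv₂_conjTranspose_mul_Qv₂, smul_add, smul_smul, smul_smul, hc, he]
  abel

/-- `localTZ` is Hermitian. [folklore] -/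
theorem localTZ_isHermitian : (localTZ n M a S₀ S₁).IsHermitian := localFixed_isHermitian _ _ _ _

/-- **THE FORM**: `re⟨A, localTZ A⟩ = ‖curl A‖² + ‖∂_{Ω₀}ᴴA‖² + a n^d·‖QA‖² + a n²·‖A_{Λ₀}‖²`.
[cite: Balaban1984PropagatorsI, (1.69) p.29 (shape)] [folklore] -/
theorem form_localTZ (A : {b // starReg n M S₀ b} → ℂ) :
    (star A ⬝ᵥ (localTZ n M a S₀ S₁ *ᵥ A)).re
      = nsq (curlR n M S₀ *ᵥ A) + nsq ((gradR n M S₀)ᴴ *ᵥ A)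
          + a * (n : ℝ) ^ d * nsq (avgR n M S₀ *ᵥ A) + a * (n : ℝ) ^ 2 * nsq (selC n M S₀ S₁ *ᵥ A) := by
  rw [localTZ, form_localFixed, nsq_Qv₂_mulVec]
  ring

/-- **THE FAITHFUL COLLARED OPERATOR IS DOMINATED BY `localTZ` WHATEVER THE COLLARED SCALAR DATA**: for ANY Hermitian `G` on ANY scalar
carrier and ANY `Qs` with `Qs G² Qsᴴ` invertible, `re⟨A, gaugeFixed (curlR S₀) (gradR S₀) G Qs (Qv₂ S₀ S₁) a A⟩ ≤ re⟨A, localTZ A⟩`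
(owner's `form_gaugeFixed_le_form_localFixed`, instance). [cite: Balaban1985BackgroundPropagators, (3.25)–(3.26) pp.394–395 (shape)] [folklore] -/
theorem form_gaugeFixed_le_form_localTZ {u : Type*} [Fintype u] [DecidableEq u]
    (G : Matrix {x // blockReg n M S₀ x} {x // blockReg n M S₀ x} ℂ) (Qs : Matrix u {x // blockReg n M S₀ x} ℂ)
    (hG : G.IsHermitian) (hK : IsUnit (gramK G Qs).det) (A : {b // starReg n M S₀ b} → ℂ) :
    (star A ⬝ᵥ (gaugeFixed (curlR n M S₀) (gradR n M S₀) G Qs (Qv₂ n M S₀ S₁) a *ᵥ A)).re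
      ≤ (star A ⬝ᵥ (localTZ n M a S₀ S₁ *ᵥ A)).re :=
  form_gaugeFixed_le_form_localFixed (curlR n M S₀) (gradR n M S₀) G Qs (Qv₂ n M S₀ S₁) a hG hK A

/-! ## §3 The outer wall's electric flux lives on collar bonds -/

/-- the divergence of the zero-extension at a site OUTSIDE `Ω₀` only sees collar bonds: it equals the divergence of the zero-extension of the
collar part. [folklore] -/
theorem div_ext_apply_eq_collar (hsub : ∀ y, S₁ y → S₀ y) (hcol : Collared n M S₀ S₁)
    (A : {b // starReg n M S₀ b} → ℂ) {x : Tor (fine n M)} (hx : ¬ blockReg n M S₀ x) :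
    ((GradOp (fine n M) (n : ℂ))ᴴ *ᵥ ext (starReg n M S₀) A) x
      = ((GradOp (fine n M) (n : ℂ))ᴴ *ᵥ ext (collar n M S₀ S₁) (selC n M S₀ S₁ *ᵥ A)) x := by
  simp only [Matrix.mulVec, dotProduct, Matrix.conjTranspose_apply]
  refine sum_congr rfl fun b _ => ?_
  by_cases h : b.1 = x ∨ x = b.1 + unitVec (fine n M) b.2
  · congr 1
    by_cases hb : starReg n M S₀ b
    · have hx' : ¬ blockReg n M S₀ b.1 ∨ ¬ blockReg n M S₀ (b.1 + unitVec (fine n M) b.2) := by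
        rcases h with h | h
        · exact Or.inl (h ▸ hx)
        · exact Or.inr (h ▸ hx)
      have hc : collar n M S₀ S₁ b := collar_of_exterior n M S₀ S₁ hsub hcol hb hx'
      rw [ext_apply_of _ _ ⟨b, hb⟩, ext_apply_of _ _ ⟨b, hc⟩, selC_mulVec]
    · have hc : ¬ collar n M S₀ S₁ b := fun hc => hb hc.1
      rw [ext_apply_of_not _ _ hb, ext_apply_of_not _ _ hc]
  · push Not at h
    rw [GradOp_apply, if_neg h.2, if_neg h.1, sub_zero, mul_zero, star_zero, zero_mul, zero_mul]

/-- **THE OUTER WALL's ELECTRIC FLUX IS CARRIED BY COLLAR BONDS**: `extFlux n M S₀ A ≤ 4d·n²·nsq (selC A)` (leaf-07-g10's crude divergence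
bound `extFlux_le_nsq` read on the collar part). [folklore] -/
theorem extFlux_le_collar (hsub : ∀ y, S₁ y → S₀ y) (hcol : Collared n M S₀ S₁) (A : {b // starReg n M S₀ b} → ℂ) :
    extFlux n M S₀ A ≤ 4 * d * (n : ℝ) ^ 2 * nsq (selC n M S₀ S₁ *ᵥ A) := by
  obtain ⟨v, hv⟩ : ∃ v : Tor (fine n M) × Fin d → ℂ, v = ext (collar n M S₀ S₁) (selC n M S₀ S₁ *ᵥ A) := ⟨_, rfl⟩
  have h1 : extFlux n M S₀ A = ∑ x : {x // ¬ blockReg n M S₀ x}, ‖((GradOp (fine n M) (n : ℂ))ᴴ *ᵥ v) x‖ ^ 2 := by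
    unfold extFlux
    exact sum_congr rfl fun x _ => by rw [div_ext_apply_eq_collar n M S₀ S₁ hsub hcol A x.2, hv]
  have h2 : (∑ x : {x // ¬ blockReg n M S₀ x}, ‖((GradOp (fine n M) (n : ℂ))ᴴ *ᵥ v) x‖ ^ 2)
      ≤ nsq ((GradOp (fine n M) (n : ℂ))ᴴ *ᵥ v) := by
    unfold nsq
    rw [← Fintype.sum_subtype_add_sum_subtype (blockReg n M S₀)
      (fun x => ‖((GradOp (fine n M) (n : ℂ))ᴴ *ᵥ v) x‖ ^ 2)]
    have h0 : 0 ≤ ∑ x : {x // blockReg n M S₀ x}, ‖((GradOp (fine n M) (n : ℂ))ᴴ *ᵥ v) x‖ ^ 2 :=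
      sum_nonneg fun _ _ => by positivity
    linarith
  have h3 := nsq_GradOp_conjTranspose_mulVec_le n M v
  have h4 : nsq v = nsq (selC n M S₀ S₁ *ᵥ A) := by rw [hv, nsq_ext]
  rw [h1, ← h4]
  exact h2.trans h3

/-! ## §4 The full gradient energy of the zero-extension, with one constant on every geometry -/

/-- **THE FULL GRADIENT ENERGY OF THE ZERO-EXTENSION IS PAID BY THE LOCAL FORM, ON EVERY GEOMETRY OF `Ω₁`**:
`Σ_ν nsq (fdiff ν (ext A)) ≤ (1 + 4d/a)·re⟨A, localTZ A⟩` (`S₁ ≤ S₀`, `Collared`, `0 < a`) — the Gaffney identity of the OUTER region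
(`gaffney_region`: `‖curl‖² + ‖∂_{Ω₀}ᴴ·‖² + extFlux = Σ_ν‖∇_ν ext A‖²`) plus §3. [folklore] -/
theorem gradEnergy_le_form_localTZ (hsub : ∀ y, S₁ y → S₀ y) (hcol : Collared n M S₀ S₁) (ha : 0 < a)
    (A : {b // starReg n M S₀ b} → ℂ) :
    ∑ ν, nsq (fdiff (fine n M) (n : ℂ) ν *ᵥ ext (starReg n M S₀) A)
      ≤ (1 + 4 * d / a) * (star A ⬝ᵥ (localTZ n M a S₀ S₁ *ᵥ A)).re := by
  have hG := gaffney_region n M S₀ A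
  have hF := extFlux_le_collar n M S₀ S₁ hsub hcol A
  rw [form_localTZ, ← hG]
  set X := nsq (curlR n M S₀ *ᵥ A) with hX
  set Y := nsq ((gradR n M S₀)ᴴ *ᵥ A) with hY
  set Q := nsq (avgR n M S₀ *ᵥ A) with hQ
  set C := nsq (selC n M S₀ S₁ *ᵥ A) with hC
  obtain ⟨hX0, hY0, hQ0, hC0⟩ : 0 ≤ X ∧ 0 ≤ Y ∧ 0 ≤ Q ∧ 0 ≤ C := ⟨nsq_nonneg _, nsq_nonneg _, nsq_nonneg _, nsq_nonneg _⟩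
  have ha0 : a ≠ 0 := ha.ne'
  have h1 : extFlux n M S₀ A ≤ (4 * d / a) * (a * (n : ℝ) ^ 2 * C) := by
    have e : (4 * d / a) * (a * (n : ℝ) ^ 2 * C) = 4 * d * (n : ℝ) ^ 2 * C := by
      field_simp
    rw [e]; exact hF
  have h2 : a * (n : ℝ) ^ 2 * C ≤ X + Y + a * (n : ℝ) ^ d * Q + a * (n : ℝ) ^ 2 * C := by
    have : 0 ≤ a * (n : ℝ) ^ d * Q := by positivity
    linarith
  have h3 : (4 * d / a) * (a * (n : ℝ) ^ 2 * C) ≤ (4 * d / a) * (X + Y + a * (n : ℝ) ^ d * Q + a * (n : ℝ) ^ 2 * C) :=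
    mul_le_mul_of_nonneg_left h2 (by positivity)
  have h4 : X + Y ≤ X + Y + a * (n : ℝ) ^ d * Q + a * (n : ℝ) ^ 2 * C := by
    have : 0 ≤ a * (n : ℝ) ^ d * Q := by positivity
    have : 0 ≤ a * (n : ℝ) ^ 2 * C := by positivity
    linarith
  calc X + Y + extFlux n M S₀ A
      ≤ (X + Y + a * (n : ℝ) ^ d * Q + a * (n : ℝ) ^ 2 * C)
          + (4 * d / a) * (X + Y + a * (n : ℝ) ^ d * Q + a * (n : ℝ) ^ 2 * C) := by linarith
    _ = (1 + 4 * d / a) * (X + Y + a * (n : ℝ) ^ d * Q + a * (n : ℝ) ^ 2 * C) := by ring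

/-- **HENCE INTERIOR W2 WITH ONE LEVEL-UNIFORM CONSTANT ON EVERY GEOMETRY**: `Σ_μ nsq (igrad μ A) ≤ (1 + 4d/a)·re⟨A, localTZ A⟩`
(the interior differences are part of the full gradient energy, `sum_nsq_fdiff_ext_eq`). [folklore] -/
theorem interiorW2_localTZ (hsub : ∀ y, S₁ y → S₀ y) (hcol : Collared n M S₀ S₁) (ha : 0 < a)
    (A : {b // starReg n M S₀ b} → ℂ) :
    ∑ μ, nsq (igrad M S₀ n μ A) ≤ (1 + 4 * d / a) * (star A ⬝ᵥ (localTZ n M a S₀ S₁ *ᵥ A)).re := by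
  have h := gradEnergy_le_form_localTZ n M a S₀ S₁ hsub hcol ha A
  rw [sum_nsq_fdiff_ext_eq] at h
  have h0 : 0 ≤ (n : ℝ) ^ 2 * ∑ y : {b // starReg n M S₀ b}, cntR n M S₀ y.1 * ‖A y‖ ^ 2 := by
    have : 0 ≤ ∑ y : {b // starReg n M S₀ b}, cntR n M S₀ y.1 * ‖A y‖ ^ 2 :=
      sum_nonneg fun y _ => mul_nonneg (cntR_nonneg n M S₀ y.1) (by positivity)
    positivity
  linarith

/-! ## §5 Coercivity with one constant, on every geometry -/

/-- the form of B5's torus operator `Δ_a = ½Curl*Curl + ∂(1 − P)∂* + a n^d Q*Q` is dominated by the LOCAL torus form (drop the projection):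
`re⟨B, Δ_a B⟩ ≤ ½‖Curl B‖² + ‖∂ᴴB‖² + a n^d‖QB‖²`. [cite: Balaban1984PropagatorsI, (1.69) p.29 (shape)] [folklore] -/
theorem re_form_DeltaA_le (B : Tor (fine n M) × Fin d → ℂ) :
    (star B ⬝ᵥ (DeltaA n M a *ᵥ B)).re
      ≤ (1 / 2) * nsq (CurlOp (fine n M) (n : ℂ) *ᵥ B) + nsq ((GradOp (fine n M) (n : ℂ))ᴴ *ᵥ B)
          + a * (n : ℝ) ^ d * nsq (QvOp n M *ᵥ B) := by
  have hc : (n : ℂ) ≠ 0 := by exact_mod_cast NeZero.ne n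
  have hPH : (PcT n M (n : ℂ)).IsHermitian := PcT_conjTranspose n M (n : ℂ)
  have h1PH : ((1 : Matrix (Tor (fine n M)) (Tor (fine n M)) ℂ) - PcT n M (n : ℂ)).IsHermitian :=
    Matrix.isHermitian_one.sub hPH
  have hPP := PcT_mul_PcT n M (n : ℂ) hc
  have h1P := one_sub_PcT_proj n M (n : ℂ) hc
  set x : Tor (fine n M) → ℂ := (GradOp (fine n M) (n : ℂ))ᴴ *ᵥ B with hx
  -- the middle term is `‖(1 − P)x‖²`
  have hmid : star B ⬝ᵥ ((GradOp (fine n M) (n : ℂ) * (1 - PcT n M (n : ℂ)) * (GradOp (fine n M) (n : ℂ))ᴴ) *ᵥ B)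
      = ((nsq (((1 : Matrix (Tor (fine n M)) (Tor (fine n M)) ℂ) - PcT n M (n : ℂ)) *ᵥ x) : ℝ) : ℂ) := by
    rw [← Matrix.mulVec_mulVec, ← Matrix.mulVec_mulVec, dotProduct_mulVec_eq_star_conjTranspose_mulVec, ← hx,
      form_proj h1PH h1P]
  -- `‖(1 − P)x‖² ≤ ‖x‖²` (Pythagoras with the complementary projection `P`)
  have hproj : nsq (((1 : Matrix (Tor (fine n M)) (Tor (fine n M)) ℂ) - PcT n M (n : ℂ)) *ᵥ x) ≤ nsq x := by
    have e : star x ⬝ᵥ x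
        = star x ⬝ᵥ (PcT n M (n : ℂ) *ᵥ x) + star x ⬝ᵥ (((1 : Matrix (Tor (fine n M)) (Tor (fine n M)) ℂ) - PcT n M (n : ℂ)) *ᵥ x) := by
      rw [Matrix.sub_mulVec, Matrix.one_mulVec, dotProduct_sub]; ring
    rw [star_dotProduct_self, form_proj hPH hPP, form_proj h1PH h1P, ← Complex.ofReal_add] at e
    have e' := Complex.ofReal_injective e
    have := nsq_nonneg (PcT n M (n : ℂ) *ᵥ x)
    linarith
  have e : star B ⬝ᵥ (DeltaA n M a *ᵥ B)
      = ((((1 / 2) * nsq (CurlOp (fine n M) (n : ℂ) *ᵥ B)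
          + nsq (((1 : Matrix (Tor (fine n M)) (Tor (fine n M)) ℂ) - PcT n M (n : ℂ)) *ᵥ x)
          + a * (n : ℝ) ^ d * nsq (QvOp n M *ᵥ B) : ℝ)) : ℂ) := by
    rw [DeltaA_eq_curl, Matrix.add_mulVec, Matrix.add_mulVec, dotProduct_add, dotProduct_add, hmid, QvAdj,
      Matrix.smul_mul, smul_smul, Matrix.smul_mulVec, Matrix.smul_mulVec, dotProduct_smul, dotProduct_smul, form_gram, form_gram,
      smul_eq_mul, smul_eq_mul]
    push_cast
    ring
  rw [e, Complex.ofReal_re]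
  linarith

/-- **B5's (1.90) READ ON THE STAR BONDS OF A REGION**: `γ_D·‖A‖² ≤ ‖curl A‖² + ‖∂_{Ω}ᴴA‖² + extFlux A + a n^d‖QA‖²` for every star field
of every region (`1 ≤ n`, `0 < a`). [cite: Balaban1984PropagatorsI, Prop. 1.1 (1.90) p.33 (kernel version of the tree, constant ours)] [folklore] -/
theorem gamD_nsq_le (hn : 1 ≤ n) (ha : 0 < a) (A : {b // starReg n M S₀ b} → ℂ) :
    gamD d a * nsq A
      ≤ nsq (curlR n M S₀ *ᵥ A) + nsq ((gradR n M S₀)ᴴ *ᵥ A) + extFlux n M S₀ A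
          + a * (n : ℝ) ^ d * nsq (avgR n M S₀ *ᵥ A) := by
  have hco := coercive_calDa M a ha n hn (ext (starReg n M S₀) A)
  rw [calDa_eq_DeltaA n hn M a ha, nsq_ext] at hco
  have h := re_form_DeltaA_le n M a (ext (starReg n M S₀) A)
  rw [← avgR_mulVec, nsq_div_ext_eq] at h
  have hc : (1 / 2) * nsq (CurlOp (fine n M) (n : ℂ) *ᵥ ext (starReg n M S₀) A) = nsq (curlR n M S₀ *ᵥ A) := by
    rw [nsq_curlR_mulVec]
  linarith

/-- the coercivity constant of the two-zone local operator: `gamTZ d a = γ_D·a/(a + 4d)`. [folklore] -/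
def gamTZ (d : ℕ) (a : ℝ) : ℝ := gamD d a * a / (a + 4 * d)

/-- `0 < gamTZ d a` for `0 < a`. [folklore] -/
theorem gamTZ_pos (ha : 0 < a) : 0 < gamTZ d a := by
  unfold gamTZ
  have := gamD_pos (d := d) a
  positivity

/-- **COERCIVITY OF THE TWO-ZONE LOCAL OPERATOR WITH ONE CONSTANT ON EVERY GEOMETRY**: `S₁ ≤ S₀`, `Collared`, `1 ≤ n`, `0 < a` ⟹
`Coercive (localTZ n M a S₀ S₁) (gamTZ d a)` — free of `n`, `M`, `S₀`, `S₁`. [folklore] -/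
theorem coercive_localTZ (hsub : ∀ y, S₁ y → S₀ y) (hcol : Collared n M S₀ S₁) (hn : 1 ≤ n) (ha : 0 < a) :
    Coercive (localTZ n M a S₀ S₁) (gamTZ d a) := by
  intro A
  have h1 := gamD_nsq_le n M a S₀ hn ha A
  have h2 := extFlux_le_collar n M S₀ S₁ hsub hcol A
  rw [form_localTZ]
  set X := nsq (curlR n M S₀ *ᵥ A) + nsq ((gradR n M S₀)ᴴ *ᵥ A) + a * (n : ℝ) ^ d * nsq (avgR n M S₀ *ᵥ A) with hX
  set C := nsq (selC n M S₀ S₁ *ᵥ A) with hC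
  set N := nsq A
  have hX0 : 0 ≤ X := by
    have := nsq_nonneg (curlR n M S₀ *ᵥ A); have := nsq_nonneg ((gradR n M S₀)ᴴ *ᵥ A)
    have := nsq_nonneg (avgR n M S₀ *ᵥ A)
    positivity
  have hC0 : 0 ≤ C := nsq_nonneg _
  have hd : (0 : ℝ) ≤ d := Nat.cast_nonneg d
  have had : 0 < a + 4 * d := by positivity
  have key : gamD d a * N ≤ X + 4 * d * (n : ℝ) ^ 2 * C := by linarith
  have key' : a * (gamD d a * N) ≤ a * X + 4 * d * (a * (n : ℝ) ^ 2 * C) := by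
    have := mul_le_mul_of_nonneg_left key ha.le
    linarith
  rw [gamTZ, div_mul_eq_mul_div, div_le_iff₀ had]
  have hXC : 0 ≤ a * (n : ℝ) ^ 2 * C := by positivity
  nlinarith [mul_nonneg hd hX0, mul_nonneg ha.le hXC, mul_nonneg hd hXC]

/-- **«THE LOCAL COLLARED PROPAGATOR EXISTS»**: `localTZ` is invertible … [folklore] -/
theorem isUnit_det_localTZ (hsub : ∀ y, S₁ y → S₀ y) (hcol : Collared n M S₀ S₁) (hn : 1 ≤ n) (ha : 0 < a) :
    IsUnit (localTZ n M a S₀ S₁).det :=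
  isUnit_det_of_coercive (gamTZ_pos a ha) (coercive_localTZ n M a S₀ S₁ hsub hcol hn ha)

/-- **… WITH `‖localTZ⁻¹‖ ≤ gamTZ⁻¹`**, uniformly in `n`, `M`, `S₀`, `S₁`. [folklore] -/
theorem opNorm_inv_localTZ_le (hsub : ∀ y, S₁ y → S₀ y) (hcol : Collared n M S₀ S₁) (hn : 1 ≤ n) (ha : 0 < a) :
    ‖(localTZ n M a S₀ S₁)⁻¹‖ ≤ (gamTZ d a)⁻¹ :=
  opNorm_inv_le_of_coercive (gamTZ_pos a ha) (coercive_localTZ n M a S₀ S₁ hsub hcol hn ha)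

end Summit.QuantumFields.BalabanUV.T4Continuum.RegionTwoZoneLocal

end
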